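import Mathlib
import HarnessLib
import Summits.Ventures.LatticeQCDFlow.Exactness.KickedProductTrajectory
import Summits.Ventures.LatticeQCDFlow.Exactness.SUNExpChart

/-!
# `SU(N)` lattice gauge fields as a kicked product system in the matrix algebra: the embedding, the exponential and logarithm defects, and the standing hypotheses

HONEST FRAMING: exact (Metropolis-corrected) sampling algorithms for lattice gauge theory;
figures of merit are autocorrelation/cost numbers at stated couplings and volumes; no
continuum-physics claim.

Venture `LatticeQCDFlow` (cell pub-lqcd), topic `Exactness`, FANOUT row 9 (eng-latcore, the
engine `latflow.core.hmc.HMC(f, β, 'leapfrog').trajectory(τ, nstep)` / `sun_2d.HMC2D` on `SU(N)`,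
`nstep ≥ 2`).  NEW WORK of the cell over Mathlib (`hasStrictFDerivAt_exp_zero`,
`HasStrictFDerivAt.to_localInverse`, `HasStrictFDerivAt.approximates_deriv_on_nhds`,
`entry_norm_bound_of_unitary`) and the tree (`KickedProductTrajectory.lean`: `PLFBounds`;
`MatrixExpChart.lean` / `SUNExpChart.lean`: `matrixLog`, `suExp`, `suLog`, `suChartSet`, `coordOf`);
nothing here is cited as a fact.  Printed counterpart, NAMED ONLY: Hall, *Lie Groups, Lie Algebras,
and Representations* (2015) §2–3 (the matrix exponential and logarithm near the identity).

THE POINT.  The `n`-step leapfrog on `SU(N)^links` is read in the real normed algebra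
`𝔸 = links → M_N(ℂ)` (`L∞` operator norm on each factor, sup over links), where the drift is the
product `W ← exp(ε ι m) · W` of `KickedProductTrajectory.lean`.  This file supplies the dictionary and
discharges the standing hypotheses `PLFBounds` QUALITATIVELY (no radius is computed):

* §1 `coeConfig U = (↑U_l)_l`, `sunGroupSet` (the configurations, `∀ l, W_l ∈ SU(N)`), `linkExp`,
  `linkLog` (link-wise `exp` / `matrixLog`), `sunJ ι : (links → E) →L 𝔸` (`p ↦ (ι p_l)_l`),
  `sunCoordOf` (its link-wise left inverse `coordOf`); **`norm_le_card_of_mem_sunGroupSet`**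
  (`‖W‖ ≤ N` on the group: unitary entries have modulus `≤ 1`); `linkExp_sunJ_mul_mem`.
* §2 **`hasStrictFDerivAt_matrixLog_one`**; **`exists_linkExp_defect`** / **`exists_linkLog_defect`** —
  for every `η > 0` a radius `ρ > 0` with `‖linkExp a − linkExp a' − (a − a')‖ ≤ η‖a − a'‖` on
  `‖a‖, ‖a'‖ ≤ ρ`, resp. `‖linkLog W − linkLog W' − (W − W')‖ ≤ η‖W − W'‖` on `‖W − 1‖, ‖W' − 1‖ ≤ ρ`,
  the latter radius also putting every such group element in `suChartSet` (strict differentiability of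
  `exp` at `0` and of its local inverse at `1`, link by link, sup norm).
* §3 `toGroupConfig u W` (the configuration `W·u` when it is one), `algForce u g W = g (W·u)`;
  **`plfBounds_sun`** — for a force increment `g` bounded by `b ≥ 0` per link and `K`-Lipschitz in the
  matrix sup norm, `PLFBounds linkExp (sunJ ι) (algForce u g) sunGroupSet N b (K·N) ρ η` from EVERY base
  configuration `u` (`N ≥ 1` the matrix size).

NOT CLAIMED: any radius or constant (inverse function theorem); the kernel, measures (next files).
-/

noncomputable section

namespace Summit.Ventures.LatticeQCDFlow.Exactness

open NormedSpace Set Filter Topology Metric Function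
open scoped Matrix Matrix.Norms.Operator NNReal

set_option backward.isDefEq.respectTransparency false

variable {n : Type*} [Fintype n] [DecidableEq n]

/-! ## §1 The algebra `links → M_N(ℂ)` and the embedding of the configurations -/

section Group

variable {L : Type*}

/-- A configuration read in the algebra: `coeConfig U = (↑U_l)_l`. -/
def coeConfig (U : L → Matrix.specialUnitaryGroup n ℂ) : L → Matrix n n ℂ := fun l => (U l : Matrix n n ℂ)

/-- Pointwise. -/
@[simp] theorem coeConfig_apply (U : L → Matrix.specialUnitaryGroup n ℂ) (l : L) :
    coeConfig U l = (U l : Matrix n n ℂ) := rfl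

/-- `coeConfig` is multiplicative. -/
theorem coeConfig_mul (U U' : L → Matrix.specialUnitaryGroup n ℂ) : coeConfig (U * U') = coeConfig U * coeConfig U' := by
  funext l; rfl

/-- `coeConfig 1 = 1`. -/
@[simp] theorem coeConfig_one : coeConfig (1 : L → Matrix.specialUnitaryGroup n ℂ) = 1 := by
  funext l; rfl

/-- `coeConfig U⁻¹ * coeConfig U = 1`. -/
theorem coeConfig_inv_mul (U : L → Matrix.specialUnitaryGroup n ℂ) : coeConfig U⁻¹ * coeConfig U = 1 := by
  rw [← coeConfig_mul, inv_mul_cancel, coeConfig_one]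

/-- `coeConfig U * coeConfig U⁻¹ = 1`. -/
theorem coeConfig_mul_inv (U : L → Matrix.specialUnitaryGroup n ℂ) : coeConfig U * coeConfig U⁻¹ = 1 := by
  rw [← coeConfig_mul, mul_inv_cancel, coeConfig_one]

/-- `coeConfig` is injective. -/
theorem coeConfig_injective : Injective (coeConfig (n := n) (L := L)) := fun _ _ h =>
  funext fun l => Subtype.ext (congr_fun h l)

/-- **The configurations**: `W ∈ sunGroupSet ↔ ∀ l, W_l ∈ SU(N)`. -/
def sunGroupSet : Set (L → Matrix n n ℂ) := {W | ∀ l, W l ∈ Matrix.specialUnitaryGroup n ℂ}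

/-- `1 ∈ sunGroupSet`. -/
theorem one_mem_sunGroupSet : (1 : L → Matrix n n ℂ) ∈ sunGroupSet (n := n) (L := L) := fun _ => Submonoid.one_mem _

/-- Configurations are in `sunGroupSet`. -/
theorem coeConfig_mem (U : L → Matrix.specialUnitaryGroup n ℂ) : coeConfig U ∈ sunGroupSet := fun l => (U l).2

/-- `sunGroupSet` is closed under products. -/
theorem mul_mem_sunGroupSet {W W' : L → Matrix n n ℂ} (hW : W ∈ sunGroupSet) (hW' : W' ∈ sunGroupSet) :
    W * W' ∈ sunGroupSet (n := n) := fun l => Submonoid.mul_mem _ (hW l) (hW' l)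

/-- **The link-wise exponential** `linkExp W = (exp W_l)_l`. -/
def linkExp (W : L → Matrix n n ℂ) : L → Matrix n n ℂ := fun l => exp (W l)

/-- Pointwise. -/
@[simp] theorem linkExp_apply (W : L → Matrix n n ℂ) (l : L) : linkExp W l = exp (W l) := rfl

/-- `linkExp 0 = 1`. -/
theorem linkExp_zero : linkExp (0 : L → Matrix n n ℂ) = 1 := by
  funext l; simp [linkExp, exp_zero]

/-- **The link-wise logarithm** `linkLog W = (log W_l)_l` (`matrixLog`, meaningful near `1`). -/
def linkLog (W : L → Matrix n n ℂ) : L → Matrix n n ℂ := fun l => matrixLog (W l)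

/-- Pointwise. -/
@[simp] theorem linkLog_apply (W : L → Matrix n n ℂ) (l : L) : linkLog W l = matrixLog (W l) := rfl

/-- `linkLog 1 = 0`. -/
theorem linkLog_one : linkLog (1 : L → Matrix n n ℂ) = 0 := by
  funext l; simp [linkLog, matrixLog_one]

variable (u : L → Matrix.specialUnitaryGroup n ℂ)

open Classical in
/-- The configuration `W · u` when it is one (and `u` otherwise — never used there). -/
def toGroupConfig (W : L → Matrix n n ℂ) : L → Matrix.specialUnitaryGroup n ℂ := fun l =>
  if h : W l * (u l : Matrix n n ℂ) ∈ Matrix.specialUnitaryGroup n ℂ then ⟨W l * (u l : Matrix n n ℂ), h⟩ else u l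

/-- On the group: `coeConfig (toGroupConfig u W) = W * coeConfig u`. -/
theorem coeConfig_toGroupConfig {W : L → Matrix n n ℂ} (hW : W ∈ sunGroupSet) :
    coeConfig (toGroupConfig u W) = W * coeConfig u := by
  funext l
  have h : W l * (u l : Matrix n n ℂ) ∈ Matrix.specialUnitaryGroup n ℂ := Submonoid.mul_mem _ (hW l) (u l).2
  simp only [coeConfig_apply, toGroupConfig, dif_pos h, Pi.mul_apply]

/-- `toGroupConfig u (coeConfig (U * u⁻¹)) = U`. -/
theorem toGroupConfig_coeConfig (U : L → Matrix.specialUnitaryGroup n ℂ) :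
    toGroupConfig u (coeConfig (U * u⁻¹)) = U := by
  apply coeConfig_injective
  rw [coeConfig_toGroupConfig u (coeConfig_mem _), coeConfig_mul, mul_assoc, coeConfig_inv_mul, mul_one]

variable {E : Type*} (g : (L → Matrix.specialUnitaryGroup n ℂ) → L → E)

/-- **The force increment read in the algebra** at base `u`: `algForce u g W = g (W · u)`. -/
def algForce (W : L → Matrix n n ℂ) : L → E := g (toGroupConfig u W)

/-- On an embedded configuration the algebra force is the force: `algForce u g (↑(U u⁻¹)) = g U`. -/
theorem algForce_coeConfig (U : L → Matrix.specialUnitaryGroup n ℂ) : algForce u g (coeConfig (U * u⁻¹)) = g U := by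
  rw [algForce, toGroupConfig_coeConfig]

end Group

/-! ## §2 Norms: the group is bounded; momenta and coordinates read in the algebra -/

section Norms

variable {L : Type*} [Fintype L]

/-- **A special unitary matrix has `L∞`-operator norm at most `N`** (its entries have modulus `≤ 1`). -/
theorem norm_le_card_of_mem_specialUnitaryGroup {U : Matrix n n ℂ} (hU : U ∈ Matrix.specialUnitaryGroup n ℂ) :
    ‖U‖ ≤ Fintype.card n := by
  have hu : U ∈ Matrix.unitaryGroup n ℂ := (Matrix.mem_specialUnitaryGroup_iff.1 hU).1
  rw [Matrix.linfty_opNorm_def]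
  have h : ((Finset.univ : Finset n).sup fun i : n => ∑ j : n, ‖U i j‖₊) ≤ (Fintype.card n : ℝ≥0) := by
    refine Finset.sup_le fun i _ => ?_
    calc ∑ j : n, ‖U i j‖₊ ≤ ∑ _j : n, (1 : ℝ≥0) := Finset.sum_le_sum fun j _ => by
            rw [← NNReal.coe_le_coe, coe_nnnorm, NNReal.coe_one]; exact entry_norm_bound_of_unitary hu i j
      _ = Fintype.card n := by simp
  exact_mod_cast h

/-- **`‖W‖ ≤ N` on `sunGroupSet`** (sup over links). -/
theorem norm_le_card_of_mem_sunGroupSet {W : L → Matrix n n ℂ} (hW : W ∈ sunGroupSet) :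
    ‖W‖ ≤ Fintype.card n :=
  (pi_norm_le_iff_of_nonneg (Nat.cast_nonneg _)).2 fun l => norm_le_card_of_mem_specialUnitaryGroup (hW l)

/-- The norm of a configuration is at most `N`. -/
theorem norm_coeConfig_le (U : L → Matrix.specialUnitaryGroup n ℂ) : ‖coeConfig U‖ ≤ Fintype.card n :=
  norm_le_card_of_mem_sunGroupSet (coeConfig_mem U)

variable {E : Type*} [NormedAddCommGroup E] [NormedSpace ℝ E] [FiniteDimensional ℝ E] (ι : E →ₗ[ℝ] Matrix n n ℂ)

/-- **The momenta read in the algebra**: `sunJ ι p = (ι p_l)_l`, a continuous linear map. -/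
def sunJ : (L → E) →L[ℝ] (L → Matrix n n ℂ) :=
  ContinuousLinearMap.pi fun l => (LinearMap.toContinuousLinearMap ι).comp (ContinuousLinearMap.proj l)

omit [Fintype n] [DecidableEq n] [Fintype L] in
/-- Pointwise. -/
@[simp] theorem sunJ_apply (p : L → E) (l : L) : sunJ (L := L) ι p l = ι (p l) := rfl

variable (hinj : Injective ι)

/-- **The coordinates read link-wise**: `sunCoordOf W = (coordOf W_l)_l`, a continuous linear map. -/
def sunCoordOf : (L → Matrix n n ℂ) →L[ℝ] (L → E) :=
  ContinuousLinearMap.pi fun l => (LinearMap.toContinuousLinearMap (coordOf ι hinj)).comp (ContinuousLinearMap.proj l)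

omit [DecidableEq n] [Fintype L] [FiniteDimensional ℝ E] in
/-- Pointwise. -/
@[simp] theorem sunCoordOf_apply (W : L → Matrix n n ℂ) (l : L) : sunCoordOf (L := L) ι hinj W l = coordOf ι hinj (W l) := rfl

omit [DecidableEq n] [Fintype L] in
/-- `sunCoordOf ∘ sunJ = id`. -/
theorem sunCoordOf_sunJ (p : L → E) : sunCoordOf (L := L) ι hinj (sunJ ι p) = p := by
  funext l; simp

variable (hι : ∀ a, (ι a)ᴴ = -ι a ∧ (ι a).trace = 0)
include hι

omit [Fintype L] in
/-- **The drift keeps the group**: `linkExp (sunJ ι v) * W ∈ sunGroupSet` for `W ∈ sunGroupSet`. -/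
theorem linkExp_sunJ_mul_mem (v : L → E) {W : L → Matrix n n ℂ} (hW : W ∈ sunGroupSet) :
    linkExp (sunJ ι v) * W ∈ sunGroupSet (n := n) :=
  mul_mem_sunGroupSet (fun l => exp_mem_specialUnitaryGroup_of_skew (hι (v l)).1 (hι (v l)).2) hW

omit [Fintype L] in
/-- The drift factor is the tree's `suExp`, link-wise: `linkExp (sunJ ι v) l = ↑(suExp ι hι (v l))`. -/
theorem linkExp_sunJ_apply (v : L → E) (l : L) : linkExp (sunJ ι v) l = (suExp ι hι (v l) : Matrix n n ℂ) := rfl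

end Norms

/-! ## §3 The exponential and the logarithm are within `η` of `1 + id` near `0` and `1` -/

section Defects

variable {L : Type*} [Fintype L]

/-- **The matrix logarithm is strictly differentiable at `1` with derivative the identity** (the
inverse function theorem, strict form). -/
theorem hasStrictFDerivAt_matrixLog_one :
    HasStrictFDerivAt (matrixLog (n := n))
      (((ContinuousLinearEquiv.refl ℝ (Matrix n n ℂ)).symm : Matrix n n ℂ ≃L[ℝ] Matrix n n ℂ) : Matrix n n ℂ →L[ℝ] Matrix n n ℂ) 1 := by
  have h := ((contDiffAt_matrixExp (n := n) 0).hasStrictFDerivAt' hasFDerivAt_matrixExp_zero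
    (by exact WithTop.top_ne_zero)).to_localInverse
  rw [exp_zero] at h
  exact h

/-- **THE EXPONENTIAL DEFECT, LINK-WISE**: for every `η > 0` there is `ρ > 0` with
`‖linkExp a − linkExp a' − (a − a')‖ ≤ η‖a − a'‖` whenever `‖a‖, ‖a'‖ ≤ ρ` (sup norms). -/
theorem exists_linkExp_defect {η : ℝ} (hη : 0 < η) :
    ∃ ρ : ℝ, 0 < ρ ∧ ∀ a a' : L → Matrix n n ℂ, ‖a‖ ≤ ρ → ‖a'‖ ≤ ρ →
      ‖linkExp a - linkExp a' - (a - a')‖ ≤ η * ‖a - a'‖ := by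
  have hc : (0 : ℝ≥0) < ⟨η, hη.le⟩ := by rw [← NNReal.coe_lt_coe]; exact hη
  obtain ⟨s, hs, happ⟩ := (hasStrictFDerivAt_exp_zero (𝕂 := ℝ) (𝔸 := Matrix n n ℂ)).approximates_deriv_on_nhds
    (c := ⟨η, hη.le⟩) (Or.inr hc)
  obtain ⟨ρ₀, hρ₀, hball⟩ := Metric.mem_nhds_iff.1 hs
  refine ⟨ρ₀ / 2, half_pos hρ₀, fun a a' ha ha' => ?_⟩
  have hmem : ∀ b : L → Matrix n n ℂ, ‖b‖ ≤ ρ₀ / 2 → ∀ l, b l ∈ s := fun b hb l =>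
    hball (mem_ball_zero_iff.2 ((norm_le_pi_norm b l).trans_lt (by linarith)))
  refine (pi_norm_le_iff_of_nonneg (by positivity)).2 fun l => ?_
  have hl := happ (a l) (hmem a ha l) (a' l) (hmem a' ha' l)
  change ‖exp (a l) - exp (a' l) - (a l - a' l)‖ ≤ η * ‖a l - a' l‖ at hl
  simp only [Pi.sub_apply, linkExp_apply]
  exact hl.trans (mul_le_mul_of_nonneg_left (norm_le_pi_norm (a - a') l) hη.le)

/-- **THE LOGARITHM DEFECT, LINK-WISE, AND THE CHART**: for every `η > 0` there is `ρ > 0` such that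
`‖linkLog W − linkLog W' − (W − W')‖ ≤ η‖W − W'‖` whenever `‖W − 1‖, ‖W' − 1‖ ≤ ρ`, and every
`U ∈ SU(N)` with `‖↑U − 1‖ ≤ ρ` lies in `suChartSet`. -/
theorem exists_linkLog_defect {η : ℝ} (hη : 0 < η) :
    ∃ ρ : ℝ, 0 < ρ ∧
      (∀ W W' : L → Matrix n n ℂ, ‖W - 1‖ ≤ ρ → ‖W' - 1‖ ≤ ρ →
        ‖linkLog W - linkLog W' - (W - W')‖ ≤ η * ‖W - W'‖) ∧
      ∀ U : Matrix.specialUnitaryGroup n ℂ, ‖(U : Matrix n n ℂ) - 1‖ ≤ ρ → U ∈ suChartSet (n := n) := by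
  have hc : (0 : ℝ≥0) < ⟨η, hη.le⟩ := by rw [← NNReal.coe_lt_coe]; exact hη
  obtain ⟨s, hs, happ⟩ := (hasStrictFDerivAt_matrixLog_one (n := n)).approximates_deriv_on_nhds
    (c := ⟨η, hη.le⟩) (Or.inr hc)
  obtain ⟨ρ₀, hρ₀, hball⟩ := Metric.mem_nhds_iff.1 hs
  obtain ⟨ρ₁, hρ₁, hball₁⟩ := Metric.mem_nhds_iff.1 (isOpen_suChartSet.mem_nhds (one_mem_suChartSet (n := n)))
  refine ⟨min (ρ₀ / 2) (ρ₁ / 2), lt_min (half_pos hρ₀) (half_pos hρ₁), fun W W' hW hW' => ?_, fun U hU => ?_⟩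
  · have hmem : ∀ B : L → Matrix n n ℂ, ‖B - 1‖ ≤ min (ρ₀ / 2) (ρ₁ / 2) → ∀ l, B l ∈ s := fun B hB l => by
      refine hball (mem_ball.2 ?_)
      rw [dist_eq_norm]
      calc ‖B l - 1‖ = ‖(B - 1) l‖ := by simp
        _ ≤ ‖B - 1‖ := norm_le_pi_norm _ l
        _ < ρ₀ := by linarith [min_le_left (ρ₀ / 2) (ρ₁ / 2)]
    refine (pi_norm_le_iff_of_nonneg (by positivity)).2 fun l => ?_
    have hl := happ (W l) (hmem W hW l) (W' l) (hmem W' hW' l)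
    change ‖matrixLog (W l) - matrixLog (W' l) - (W l - W' l)‖ ≤ η * ‖W l - W' l‖ at hl
    simp only [Pi.sub_apply, linkLog_apply]
    exact hl.trans (mul_le_mul_of_nonneg_left (norm_le_pi_norm (W - W') l) hη.le)
  · refine hball₁ (mem_ball.2 ?_)
    calc dist U 1 = ‖(U : Matrix n n ℂ) - 1‖ := by rw [Subtype.dist_eq, dist_eq_norm]; rfl
      _ ≤ min (ρ₀ / 2) (ρ₁ / 2) := hU
      _ < ρ₁ := by linarith [min_le_right (ρ₀ / 2) (ρ₁ / 2)]

end Defects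

/-! ## §4 The standing hypotheses from every base configuration -/

section Bounds

variable {L : Type*} [Fintype L]
variable {E : Type*} [NormedAddCommGroup E] [NormedSpace ℝ E] [FiniteDimensional ℝ E]
  (ι : E →ₗ[ℝ] Matrix n n ℂ) (hι : ∀ a, (ι a)ᴴ = -ι a ∧ (ι a).trace = 0)
variable {u : L → Matrix.specialUnitaryGroup n ℂ} {g : (L → Matrix.specialUnitaryGroup n ℂ) → L → E}
include hι

/-- **THE STANDING HYPOTHESES HOLD FROM EVERY BASE CONFIGURATION.**  For a force increment bounded by
`b ≥ 0` per link and `K`-Lipschitz in the matrix sup norm (`K ≥ 0`), and a radius `ρ > 0` on which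
the exponential defect is `≤ η`, `0 < η ≤ 1`:
`PLFBounds linkExp (sunJ ι) (algForce u g) sunGroupSet N b (K·N) ρ η`, `N ≥ 1` the matrix size. -/
theorem plfBounds_sun [Nonempty n] {b K ρ η : ℝ} (hb0 : 0 ≤ b) (hb : ∀ U l, ‖g U l‖ ≤ b) (hK0 : 0 ≤ K)
    (hK : ∀ U U', ‖g U - g U'‖ ≤ K * ‖coeConfig U - coeConfig U'‖) (hρ : 0 < ρ) (hη0 : 0 < η) (hη1 : η ≤ 1)
    (hdef : ∀ a a' : L → Matrix n n ℂ, ‖a‖ ≤ ρ → ‖a'‖ ≤ ρ → ‖linkExp a - linkExp a' - (a - a')‖ ≤ η * ‖a - a'‖) :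
    PLFBounds linkExp (sunJ ι) (algForce u g) sunGroupSet (Fintype.card n) b (K * Fintype.card n) ρ η where
  one_mem := one_mem_sunGroupSet
  mul_mem v W hW := linkExp_sunJ_mul_mem ι hι v hW
  norm_le W hW := norm_le_card_of_mem_sunGroupSet hW
  one_le := by exact_mod_cast Fintype.card_pos
  force_le W _ := (pi_norm_le_iff_of_nonneg hb0).2 fun l => hb _ l
  force_lip W hW W' hW' := by
    unfold algForce
    refine (hK _ _).trans ?_
    rw [coeConfig_toGroupConfig u hW, coeConfig_toGroupConfig u hW', ← sub_mul, mul_assoc]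
    exact mul_le_mul_of_nonneg_left (((norm_mul_le _ _).trans
      (mul_le_mul_of_nonneg_left (norm_coeConfig_le u) (norm_nonneg _))).trans (le_of_eq (mul_comm _ _))) hK0
  lip_nonneg := mul_nonneg hK0 (Nat.cast_nonneg _)
  ex_zero := linkExp_zero
  ex_defect := hdef
  defect_nonneg := hη0.le
  defect_le_one := hη1
  radius_nonneg := hρ.le

end Bounds

end Summit.Ventures.LatticeQCDFlow.Exactness
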